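import Summits.QuantumFields.YangMills.Theorems.UnitScaleTiltProp7CornerTreeTubeLetters
import HarnessLib

/-!
# Route `UnitScaleTilt`, crux K1 «MinimiserStabilityRegPr» (stmt-QuantumFields-19200), LANE II (QB) ∕ (R-LEGS): THE FLAT CORNER-FRAME LEGS ON `ℤ³` —
# `‖Σ_{j<k} [F̂(Lᵏ⁻ʲy)[Q_j(1)A] − F̂(Lᵏ⁻ʲ(y+e_μ))[Q_j(1)A]]‖² ≤ C(L,N)·Lᵏ·GradE_A(box(Lᵏy, 6Lᵏ))`, K-UNIFORM (nested means; no log)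

Cell `ym3-torus`, width seat `ym3-torus-px19` (gen 6; pen (R-LEGS)).  THEOREMS ONLY (0 `def`, 0 `sorry`); `--supports stmt-QuantumFields-19200 --as helper`, count-neutral.
YM₃ on T³ is a ladder rung (R3), not d = 4, not Clay; nothing here claims a stub, the crux or the gap.  This is the `ℤ³` core of the flat certificate `rlegs_flat`
(SIGNATURE-0 texts 2026-08-29); the member-level reading (periodic pull-back `X♯`, `coordT3`, torus sums) is a separate file.

MECHANISM (bus 2026-08-29 «nested means, no log»).  `Q_j(1)A(z,κ) = Lʲ·Tub_j(z,κ)`, `Tub_j` = the honest average of `A(·,κ)` over the `L^{4j}` slots `Lʲz + r + i e_κ`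
(lit ✓`linQIter_eq_linQ_pow`, ✓`linQ_eq_sum`); each slot point is hit `≤ Lʲ` times; `F̂` is bounded by the box (F1 ✓`normSq_Fhat_le`); the two tube averages at distance `ℓ`
are compared through chains of concentric box means (F1 ✓`normSq_avg_comp_sub_boxMean_le`, ✓`normSq_boxMean_sub_boxMean_le`) with per-scale cost `O(L²·L^{−i})` (d = 3
capacity), so level `j` costs `O(Lʲ)·E` and the dyadic level sum (★px6 ✓`norm_sq_sum_range_le_two_mul_dyadic`, ✓`dyadic_level_sum_le`) gives `O(Lᵏ)·E = O(ℓ)·E`.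
THIS FILE (part 1 of the `ℤ³` core): §1 `linQIter_eq_smul_avg` (tube = `Lʲ ×` slot average), `card_slot_fibre_le` (multiplicity `≤ Lʲ`), `slot_mem_box`, ★`normSq_tubeAvg_sub_boxMean_le`;
§2 `gradE_mono`, `box_subset_box`, ★`normSq_boxMean_step_le` (one scale: `(5NL²∕32)·L^{−i}`), ★`norm_boxMean_chain_le` (the geometric chain).  Part 2 (levels, the
coarse gradient of `r₁`) is the next file.  HONEST SCOPE: lattice bookkeeping; no YM content.

References: T. Bałaban, CMP 98 (1985) 17–51 [Balaban1985Averaging]; M. Giaquinta (1983) [Giaquinta1984] Ch. III §1; T. Bałaban, CMP 89 (1983) 571–597 [Balaban1983RegularityDecay].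
-/

set_option autoImplicit false

noncomputable section

open scoped BigOperators Matrix.Norms.L2Operator
open Finset

namespace Summit.QuantumFields.YangMills.Theorems.Prop7CornerFrameLegsFlatZd

open Literature.MathematicalPhysics.QuantumFieldTheory.Balaban1983to89
open Literature.MathematicalPhysics.QuantumFieldTheory.Balaban1983to89.B4Eq19LatticeOperators (Zd box unitVec mem_box)
open B7Prop1Explicit (asum treeWord boxVec l1 e)
open B7Prop3Flat (Fhat linQ)
open B7Prop4Flat (linQIter linQIter_eq_linQ_pow linQ_eq_sum)
open Summit.QuantumFields.YangMills.Theorems.Prop7LatticeBoxPoincareCov (card_box_eq)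
open Summit.QuantumFields.YangMills.Theorems.Prop7SliceBoundBookkeeping (norm_sq_sum_range_le_two_mul_dyadic dyadic_level_sum_le geom_sum_range_inv_le norm_sq_sum_le_card_mul)
open Summit.QuantumFields.YangMills.Theorems.Prop7CornerTreeTubeLetters (normSq_Fhat_le Fhat_sub normSq_boxMean_sub_boxMean_le normSq_avg_comp_sub_boxMean_le)

variable {N : ℕ}

/-! ## §1 The cornered tube `Q_j(1)A` is `Lʲ ×` an honest slot average -/

/-- The slot map of the level-`j` tube at the `Lʲ`-bond `(z, κ)`: `(r, i) ↦ Lʲz + r + i·e_κ`. (Inline letter; no `def`.) -/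
theorem linQIter_eq_smul_avg (L : ℕ) (hL : 1 ≤ L) (A : Zd 3 → Fin 3 → Matrix (Fin N) (Fin N) ℂ) (j : ℕ) (z : Zd 3) (κ : Fin 3) :
    linQIter L A j z κ
      = ((L : ℝ) ^ j) • (((Fintype.card ((Fin 3 → Fin (L ^ j)) × Fin (L ^ j)) : ℝ)⁻¹)
          • ∑ σ : (Fin 3 → Fin (L ^ j)) × Fin (L ^ j), A ((((L ^ j : ℕ) : ℤ)) • z + boxVec (L ^ j) σ.1 + ((σ.2 : ℕ) : ℤ) • e κ) κ) := by
  rw [linQIter_eq_linQ_pow, linQ_eq_sum, Fintype.sum_prod_type, smul_smul, Finset.smul_sum]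
  refine Finset.sum_congr rfl fun r _ => ?_
  congr 1
  rw [Fintype.card_prod, Fintype.card_fun, Fintype.card_fin, Fintype.card_fin]
  push_cast
  have hL0 : (0 : ℝ) < (L : ℝ) := by exact_mod_cast (by omega : 0 < L)
  have hLj : (0 : ℝ) < (L : ℝ) ^ j := by positivity
  field_simp

/-- Fibre multiplicity of the slot map: a point is hit by at most `Lʲ` slots (the segment index `i` determines the box offset `r`). [folklore] -/
theorem card_slot_fibre_le (L : ℕ) (j : ℕ) (z : Zd 3) (κ : Fin 3) (p : Zd 3) :
    ((Finset.univ : Finset ((Fin 3 → Fin (L ^ j)) × Fin (L ^ j))).filter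
        (fun σ => (((L ^ j : ℕ) : ℤ)) • z + boxVec (L ^ j) σ.1 + ((σ.2 : ℕ) : ℤ) • e κ = p)).card ≤ L ^ j := by
  classical
  -- the projection to the segment index is injective on the fibre
  have hinj : Set.InjOn (fun σ : (Fin 3 → Fin (L ^ j)) × Fin (L ^ j) => σ.2)
      ↑((Finset.univ : Finset ((Fin 3 → Fin (L ^ j)) × Fin (L ^ j))).filter
        (fun σ => (((L ^ j : ℕ) : ℤ)) • z + boxVec (L ^ j) σ.1 + ((σ.2 : ℕ) : ℤ) • e κ = p)) := by
    intro σ hσ τ hτ h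
    simp only [Finset.coe_filter, Finset.mem_univ, true_and, Set.mem_setOf_eq] at hσ hτ
    have h' : σ.2 = τ.2 := h
    have hr : boxVec (L ^ j) σ.1 = boxVec (L ^ j) τ.1 := by
      have := hσ.trans hτ.symm
      rw [h'] at this
      have := add_right_cancel this
      exact add_left_cancel this
    have h1 : σ.1 = τ.1 := by
      funext ν
      have := congrFun hr ν
      simp only [boxVec] at this
      exact Fin.ext (by exact_mod_cast this)
    exact Prod.ext h1 h'
  calc ((Finset.univ : Finset ((Fin 3 → Fin (L ^ j)) × Fin (L ^ j))).filter
        (fun σ => (((L ^ j : ℕ) : ℤ)) • z + boxVec (L ^ j) σ.1 + ((σ.2 : ℕ) : ℤ) • e κ = p)).card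
      = (((Finset.univ : Finset ((Fin 3 → Fin (L ^ j)) × Fin (L ^ j))).filter
        (fun σ => (((L ^ j : ℕ) : ℤ)) • z + boxVec (L ^ j) σ.1 + ((σ.2 : ℕ) : ℤ) • e κ = p)).image (fun σ => σ.2)).card :=
        (Finset.card_image_of_injOn hinj).symm
    _ ≤ (Finset.univ : Finset (Fin (L ^ j))).card := Finset.card_le_card (Finset.subset_univ _)
    _ = L ^ j := by rw [Finset.card_univ, Fintype.card_fin]

/-- Every slot point lies in the box of radius `2Lʲ` centred at the corner `Lʲz`. [folklore] -/
theorem slot_mem_box (L : ℕ) (j : ℕ) (z : Zd 3) (κ : Fin 3) (σ : (Fin 3 → Fin (L ^ j)) × Fin (L ^ j)) :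
    (((L ^ j : ℕ) : ℤ)) • z + boxVec (L ^ j) σ.1 + ((σ.2 : ℕ) : ℤ) • e κ ∈ box ((((L ^ j : ℕ) : ℤ)) • z) (2 * ((L ^ j : ℕ) : ℤ)) := by
  rw [mem_box]
  intro ν
  have h1 : (0 : ℤ) ≤ ((σ.1 ν : ℕ) : ℤ) := by positivity
  have h2 : ((σ.1 ν : ℕ) : ℤ) < ((L ^ j : ℕ) : ℤ) := by exact_mod_cast (σ.1 ν).isLt
  have h3 : (0 : ℤ) ≤ ((σ.2 : ℕ) : ℤ) := by positivity
  have h4 : ((σ.2 : ℕ) : ℤ) < ((L ^ j : ℕ) : ℤ) := by exact_mod_cast σ.2.isLt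
  simp only [Pi.add_apply, Pi.smul_apply, boxVec, smul_eq_mul, e, Pi.single_apply]
  split_ifs with hνκ
  · rw [mul_one, abs_le]; constructor <;> linarith
  · rw [mul_zero, add_zero, abs_le]; constructor <;> linarith

/-- ★ **TUBE AVERAGE vs BOX MEAN** (level `j`, one bond): with `Tub_j(z,κ) := L^{−j}·Q_j(1)A(z,κ)` and `B := box(Lʲz, 2Lʲ)`,
`‖Tub_j(z,κ) − mean_B A(·,κ)‖² ≤ (Lʲ∕L^{4j})·N·(2Lʲ)(4Lʲ+1)·GradE_{A(·,κ)}(B)` (F1 §3 with `#s = L^{4j}`, `μ = Lʲ`). [cite: Balaban1985Averaging, (122)–(127) pp.36–37] -/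
theorem normSq_tubeAvg_sub_boxMean_le [NeZero N] (L : ℕ) (hL : 1 ≤ L) (A : Zd 3 → Fin 3 → Matrix (Fin N) (Fin N) ℂ) (j : ℕ) (z : Zd 3) (κ : Fin 3) :
    ‖((Fintype.card ((Fin 3 → Fin (L ^ j)) × Fin (L ^ j)) : ℝ)⁻¹)
          • ∑ σ : (Fin 3 → Fin (L ^ j)) × Fin (L ^ j), A ((((L ^ j : ℕ) : ℤ)) • z + boxVec (L ^ j) σ.1 + ((σ.2 : ℕ) : ℤ) • e κ) κ
        - ((((box ((((L ^ j : ℕ) : ℤ)) • z) (2 * ((L ^ j : ℕ) : ℤ))).card : ℝ) : ℂ))⁻¹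
          • ∑ x ∈ box ((((L ^ j : ℕ) : ℤ)) • z) (2 * ((L ^ j : ℕ) : ℤ)), A x κ‖ ^ 2
      ≤ (((L ^ j : ℕ) : ℝ) / ((L ^ j : ℕ) : ℝ) ^ 4) * (N * ((((2 * ((L ^ j : ℕ) : ℤ)) : ℤ) : ℝ) * (2 * (((2 * ((L ^ j : ℕ) : ℤ)) : ℤ) : ℝ) + 1)))
          * ∑ y ∈ box ((((L ^ j : ℕ) : ℤ)) • z) (2 * ((L ^ j : ℕ) : ℤ)), ∑ ν,
              (if y + unitVec ν ∈ box ((((L ^ j : ℕ) : ℤ)) • z) (2 * ((L ^ j : ℕ) : ℤ)) then ‖A (y + unitVec ν) κ - A y κ‖ ^ 2 else 0) := by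
  classical
  have hLj : 0 < L ^ j := pow_pos (by omega) j
  have hcard : (Finset.univ : Finset ((Fin 3 → Fin (L ^ j)) × Fin (L ^ j))).card = (L ^ j) ^ 4 := by
    rw [Finset.card_univ, Fintype.card_prod, Fintype.card_fun, Fintype.card_fin, Fintype.card_fin]; ring
  have hs : 0 < (Finset.univ : Finset ((Fin 3 → Fin (L ^ j)) × Fin (L ^ j))).card := by rw [hcard]; positivity
  have hR : (0 : ℤ) ≤ 2 * ((L ^ j : ℕ) : ℤ) := by positivity
  have h := normSq_avg_comp_sub_boxMean_le (N := N) (Finset.univ : Finset ((Fin 3 → Fin (L ^ j)) × Fin (L ^ j))) hs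
    (fun σ => (((L ^ j : ℕ) : ℤ)) • z + boxVec (L ^ j) σ.1 + ((σ.2 : ℕ) : ℤ) • e κ) hR
    (fun σ _ => slot_mem_box L j z κ σ) (fun p _ => card_slot_fibre_le L j z κ p) (fun x => A x κ)
  rw [Finset.card_univ] at h
  have hc : (((Fintype.card ((Fin 3 → Fin (L ^ j)) × Fin (L ^ j)) : ℕ) : ℝ)) = ((L ^ j : ℕ) : ℝ) ^ 4 := by
    rw [← Finset.card_univ, hcard]; push_cast; ring
  rw [← hc]
  exact h

/-! ## §2 The concentric chain of box means: per-scale cost `O(L²·L^{−i})` (d = 3 capacity), geometric total -/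

/-- The gradient energy of a box is monotone in the box. [folklore] -/
theorem gradE_mono {c c' : Zd 3} {R R' : ℤ} (h : box c R ⊆ box c' R') (F : Zd 3 → Matrix (Fin N) (Fin N) ℂ) :
    ∑ y ∈ box c R, ∑ ν, (if y + unitVec ν ∈ box c R then ‖F (y + unitVec ν) - F y‖ ^ 2 else 0)
      ≤ ∑ y ∈ box c' R', ∑ ν, (if y + unitVec ν ∈ box c' R' then ‖F (y + unitVec ν) - F y‖ ^ 2 else 0) := by
  have h1 : ∑ y ∈ box c R, ∑ ν, (if y + unitVec ν ∈ box c R then ‖F (y + unitVec ν) - F y‖ ^ 2 else 0)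
      ≤ ∑ y ∈ box c R, ∑ ν, (if y + unitVec ν ∈ box c' R' then ‖F (y + unitVec ν) - F y‖ ^ 2 else 0) := by
    refine Finset.sum_le_sum fun y _ => Finset.sum_le_sum fun ν _ => ?_
    by_cases hy : y + unitVec ν ∈ box c R
    · rw [if_pos hy, if_pos (h hy)]
    · rw [if_neg hy]
      by_cases hy' : y + unitVec ν ∈ box c' R'
      · rw [if_pos hy']; positivity
      · rw [if_neg hy']
  refine h1.trans (Finset.sum_le_sum_of_subset_of_nonneg h fun y _ _ => Finset.sum_nonneg fun ν _ => ?_)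
  by_cases hy' : y + unitVec ν ∈ box c' R'
  · rw [if_pos hy']; positivity
  · rw [if_neg hy']

/-- Concentric boxes are nested. [folklore] -/
theorem box_subset_box {c : Zd 3} {R R' : ℤ} (h : R ≤ R') : box c R ⊆ box c R' := by
  intro y hy
  rw [mem_box] at hy ⊢
  exact fun i => (hy i).trans h

/-- `2Lⁱ ≤ 2L^{i+1}` in `ℤ`. [folklore] -/
theorem two_mul_pow_le_succ (L : ℕ) (hL : 1 ≤ L) (i : ℕ) : 2 * ((L ^ i : ℕ) : ℤ) ≤ 2 * ((L ^ (i + 1) : ℕ) : ℤ) := by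
  have : L ^ i ≤ L ^ (i + 1) := Nat.pow_le_pow_right (by omega) (Nat.le_succ i)
  exact_mod_cast Nat.mul_le_mul_left 2 this

set_option maxHeartbeats 400000 in
-- HEARTBEAT rule (README): box-mean terms are large; the coefficient algebra measured > 200k; decl-local.
/-- **ONE SCALE**: `‖mean_{box(c,2Lⁱ)} F − mean_{box(c,2L^{i+1})} F‖² ≤ (5N L²∕32)·L^{−i}·GradE(box(c, 2L^{i+1}))` (F1 §2 with `#box(c,2Lⁱ) = (4Lⁱ+1)³ ≥ 64L^{3i}`,
`R′(2R′+1) = 2L^{i+1}(4L^{i+1}+1) ≤ 10L^{2i+2}`). [cite: Giaquinta1984, Ch. III §1 Thm 1.2 p.70] -/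
theorem normSq_boxMean_step_le [NeZero N] (L : ℕ) (hL : 1 ≤ L) (c : Zd 3) (F : Zd 3 → Matrix (Fin N) (Fin N) ℂ) (i : ℕ) :
    ‖((((box c (2 * ((L ^ i : ℕ) : ℤ))).card : ℝ) : ℂ))⁻¹ • ∑ x ∈ box c (2 * ((L ^ i : ℕ) : ℤ)), F x
        - ((((box c (2 * ((L ^ (i + 1) : ℕ) : ℤ))).card : ℝ) : ℂ))⁻¹ • ∑ x ∈ box c (2 * ((L ^ (i + 1) : ℕ) : ℤ)), F x‖ ^ 2
      ≤ (5 * N * (L : ℝ) ^ 2 / 32) * ((L : ℝ) ^ i)⁻¹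
          * ∑ y ∈ box c (2 * ((L ^ (i + 1) : ℕ) : ℤ)), ∑ ν,
              (if y + unitVec ν ∈ box c (2 * ((L ^ (i + 1) : ℕ) : ℤ)) then ‖F (y + unitVec ν) - F y‖ ^ 2 else 0) := by
  have hL0 : (0 : ℝ) < L := by exact_mod_cast (by omega : 0 < L)
  have hLi : (0 : ℝ) < (L : ℝ) ^ i := by positivity
  have hsub : box c (2 * ((L ^ i : ℕ) : ℤ)) ⊆ box c (2 * ((L ^ (i + 1) : ℕ) : ℤ)) := box_subset_box (two_mul_pow_le_succ L hL i)
  have h := normSq_boxMean_sub_boxMean_le (N := N) (z := c) (z' := c) (R := 2 * ((L ^ i : ℕ) : ℤ)) (R' := 2 * ((L ^ (i + 1) : ℕ) : ℤ))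
    (by positivity) (by positivity) hsub F
  refine h.trans (mul_le_mul_of_nonneg_right ?_ (Finset.sum_nonneg fun _ _ => Finset.sum_nonneg fun _ _ => by split_ifs <;> positivity))
  -- the coefficient
  have hcard : ((box c (2 * ((L ^ i : ℕ) : ℤ))).card : ℝ) = (4 * (L : ℝ) ^ i + 1) ^ 3 := by
    rw [card_box_eq c (2 * ((L ^ i : ℕ) : ℤ)) (4 * L ^ i) (by push_cast; ring)]
    push_cast; ring
  rw [hcard]
  have h64 : 64 * ((L : ℝ) ^ i) ^ 3 ≤ (4 * (L : ℝ) ^ i + 1) ^ 3 := by nlinarith [hLi, pow_pos hLi 2, pow_pos hLi 3]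
  have hLi1 : (1 : ℝ) ≤ (L : ℝ) ^ (i + 1) := one_le_pow₀ (by exact_mod_cast hL)
  have hsq : (L : ℝ) ^ (i + 1) ≤ (L : ℝ) ^ (i + 1) * (L : ℝ) ^ (i + 1) := le_mul_of_one_le_right (by positivity) hLi1
  have hnum : (N : ℝ) * ((((2 * ((L ^ (i + 1) : ℕ) : ℤ) : ℤ) : ℝ)) * (2 * (((2 * ((L ^ (i + 1) : ℕ) : ℤ) : ℤ) : ℝ)) + 1))
      ≤ N * (10 * ((L : ℝ) ^ (i + 1)) ^ 2) := by
    push_cast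
    refine mul_le_mul_of_nonneg_left ?_ (Nat.cast_nonneg N)
    nlinarith [hsq]
  have hpos : (0 : ℝ) < (4 * (L : ℝ) ^ i + 1) ^ 3 := by positivity
  rw [div_le_iff₀ hpos]
  calc (N : ℝ) * ((((2 * ((L ^ (i + 1) : ℕ) : ℤ) : ℤ) : ℝ)) * (2 * (((2 * ((L ^ (i + 1) : ℕ) : ℤ) : ℤ) : ℝ)) + 1))
      ≤ N * (10 * ((L : ℝ) ^ (i + 1)) ^ 2) := hnum
    _ = (5 * N * (L : ℝ) ^ 2 / 32) * ((L : ℝ) ^ i)⁻¹ * (64 * ((L : ℝ) ^ i) ^ 3) := by field_simp; ring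
    _ ≤ (5 * N * (L : ℝ) ^ 2 / 32) * ((L : ℝ) ^ i)⁻¹ * (4 * (L : ℝ) ^ i + 1) ^ 3 :=
        mul_le_mul_of_nonneg_left h64 (by positivity)

/-- `((√L)⁻¹)ᵏ`, squared, is `(Lᵏ)⁻¹`. [folklore] -/
theorem sqrt_inv_pow_sq (L : ℕ) (k : ℕ) : (((Real.sqrt (L : ℝ))⁻¹) ^ k) ^ 2 = ((L : ℝ) ^ k)⁻¹ := by
  rw [← pow_mul, show k * 2 = 2 * k from mul_comm _ _, pow_mul, inv_pow, Real.sq_sqrt (Nat.cast_nonneg L), inv_pow]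

set_option maxHeartbeats 400000 in
-- HEARTBEAT rule (README): the chain induction manipulates two long box-mean terms per step; measured > 200k; decl-local.
/-- ★ **THE CHAIN**: for `j ≤ k`, `‖mean_{box(c,2Lʲ)} F − mean_{box(c,2Lᵏ)} F‖ ≤ √((5NL²∕32)·GradE(box(c,2Lᵏ))) · Σ_{i∈[j,k)} (√L)^{−i}` — geometric.
[cite: Giaquinta1984, Ch. III §1 Thm 1.2 p.70; Balaban1983RegularityDecay, (2.27) p.580] -/
theorem norm_boxMean_chain_le [NeZero N] (L : ℕ) (hL : 1 ≤ L) (c : Zd 3) (F : Zd 3 → Matrix (Fin N) (Fin N) ℂ) (j : ℕ) :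
    ∀ k : ℕ, j ≤ k →
    ‖((((box c (2 * ((L ^ j : ℕ) : ℤ))).card : ℝ) : ℂ))⁻¹ • ∑ x ∈ box c (2 * ((L ^ j : ℕ) : ℤ)), F x
        - ((((box c (2 * ((L ^ k : ℕ) : ℤ))).card : ℝ) : ℂ))⁻¹ • ∑ x ∈ box c (2 * ((L ^ k : ℕ) : ℤ)), F x‖
      ≤ Real.sqrt ((5 * N * (L : ℝ) ^ 2 / 32) * ∑ y ∈ box c (2 * ((L ^ k : ℕ) : ℤ)), ∑ ν,
              (if y + unitVec ν ∈ box c (2 * ((L ^ k : ℕ) : ℤ)) then ‖F (y + unitVec ν) - F y‖ ^ 2 else 0))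
          * ∑ i ∈ Finset.Ico j k, ((Real.sqrt L)⁻¹) ^ i := by
  intro k hjk
  induction k, hjk using Nat.le_induction with
  | base => simp
  | succ k hjk ih =>
    have hL0 : (0 : ℝ) < L := by exact_mod_cast (by omega : 0 < L)
    have ha : 0 ≤ (5 * N * (L : ℝ) ^ 2 / 32) := by positivity
    -- abbreviations for the three means and two energies
    obtain ⟨mj, hmj⟩ : ∃ m, m = ((((box c (2 * ((L ^ j : ℕ) : ℤ))).card : ℝ) : ℂ))⁻¹ • ∑ x ∈ box c (2 * ((L ^ j : ℕ) : ℤ)), F x := ⟨_, rfl⟩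
    obtain ⟨mk, hmk⟩ : ∃ m, m = ((((box c (2 * ((L ^ k : ℕ) : ℤ))).card : ℝ) : ℂ))⁻¹ • ∑ x ∈ box c (2 * ((L ^ k : ℕ) : ℤ)), F x := ⟨_, rfl⟩
    obtain ⟨mk1, hmk1⟩ : ∃ m, m = ((((box c (2 * ((L ^ (k + 1) : ℕ) : ℤ))).card : ℝ) : ℂ))⁻¹ • ∑ x ∈ box c (2 * ((L ^ (k + 1) : ℕ) : ℤ)), F x := ⟨_, rfl⟩
    obtain ⟨E, hE⟩ : ∃ E : ℝ, E = ∑ y ∈ box c (2 * ((L ^ k : ℕ) : ℤ)), ∑ ν,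
              (if y + unitVec ν ∈ box c (2 * ((L ^ k : ℕ) : ℤ)) then ‖F (y + unitVec ν) - F y‖ ^ 2 else 0) := ⟨_, rfl⟩
    obtain ⟨E', hE'⟩ : ∃ E : ℝ, E = ∑ y ∈ box c (2 * ((L ^ (k + 1) : ℕ) : ℤ)), ∑ ν,
              (if y + unitVec ν ∈ box c (2 * ((L ^ (k + 1) : ℕ) : ℤ)) then ‖F (y + unitVec ν) - F y‖ ^ 2 else 0) := ⟨_, rfl⟩
    rw [← hmj, ← hmk, ← hE] at ih
    rw [← hmj, ← hmk1, ← hE']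
    have hEE : E ≤ E' := by rw [hE, hE']; exact gradE_mono (box_subset_box (two_mul_pow_le_succ L hL k)) F
    have hE0' : 0 ≤ E' := by rw [hE']; exact Finset.sum_nonneg fun _ _ => Finset.sum_nonneg fun _ _ => by split_ifs <;> positivity
    -- the last step
    have hstep : ‖mk - mk1‖ ^ 2 ≤ (5 * N * (L : ℝ) ^ 2 / 32) * ((L : ℝ) ^ k)⁻¹ * E' := by
      rw [hmk, hmk1, hE']; exact normSq_boxMean_step_le (N := N) L hL c F k
    have hstep' : ‖mk - mk1‖ ≤ Real.sqrt ((5 * N * (L : ℝ) ^ 2 / 32) * E') * ((Real.sqrt L)⁻¹) ^ k := by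
      have hb : 0 ≤ Real.sqrt ((5 * N * (L : ℝ) ^ 2 / 32) * E') * ((Real.sqrt L)⁻¹) ^ k := by positivity
      refine (pow_le_pow_iff_left₀ (norm_nonneg _) hb two_ne_zero).mp ?_
      rw [mul_pow, Real.sq_sqrt (by positivity), sqrt_inv_pow_sq]
      calc ‖mk - mk1‖ ^ 2 ≤ (5 * N * (L : ℝ) ^ 2 / 32) * ((L : ℝ) ^ k)⁻¹ * E' := hstep
        _ = 5 * N * (L : ℝ) ^ 2 / 32 * E' * ((L : ℝ) ^ k)⁻¹ := by ring
    -- induction hypothesis with the larger energy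
    have ih' : ‖mj - mk‖ ≤ Real.sqrt ((5 * N * (L : ℝ) ^ 2 / 32) * E') * ∑ i ∈ Finset.Ico j k, ((Real.sqrt L)⁻¹) ^ i :=
      ih.trans (mul_le_mul_of_nonneg_right (Real.sqrt_le_sqrt (mul_le_mul_of_nonneg_left hEE ha))
        (Finset.sum_nonneg fun _ _ => by positivity))
    rw [Finset.sum_Ico_succ_top hjk, mul_add]
    exact (norm_sub_le_norm_sub_add_norm_sub mj mk mk1).trans (add_le_add ih' hstep')

end Summit.QuantumFields.YangMills.Theorems.Prop7CornerFrameLegsFlatZd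

end
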